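import Summits.BirchSwinnertonDyer.BirchSwinnertonDyer.Theses.SignedBalanceX9
import Summits.BirchSwinnertonDyer.BirchSwinnertonDyer.Theorems.SignedBalanceX9CoprimeFrameSupply
import HarnessLib

/-!
# Route `SignedBalanceX9`: the re-typed support `TwistedAnalyticMuZeroCoprimeX9OfPrint` CLOSED BY NAME

Lead prover seat `bsd-line-sbx9-p1` (line coprime-frame of crux `TwistedAnalyticMuZeroCoprimeX9`, item
stmt-BirchSwinnertonDyer-25216), cell `pub/bsd-print-x9`. THEOREMS ONLY (no definition, no named fact, no `sorry`).

The route's support `TwistedAnalyticMuZeroCoprimeX9OfPrint := Literature.NumberTheory.QuadraticFields.BRR2022_thm_1 →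
AnalyticMuZeroX9 → PublishedInputsX9 → TwistedAnalyticMuZeroCoprimeX9` (item stmt-BirchSwinnertonDyer-26944, route rev 10;
the coprime twisted analytic `μ = 0` crux 25216 with its inputs explicit) is, once unfolded, LITERALLY the landed kernel
theorem `SignedBalanceX9CoprimeFrame.twistedAnalyticMuZeroCoprimeX9_of_publishedInputs` (p607311): (F) the real
quadratic side by Dirichlet/CRT (`stub_twistSideDiscriminantX9`, p606505); (K) the coprime split-discriminant supply
from Beckwith–Raum–Richter 2022 Thm. 1 (`coprimeSplitDiscriminantSupply_of_brr2022`); (U) the three unit coefficients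
from Greenberg's analytic `μ = 0` ON CLASS X9 (`AnalyticMuZeroX9`, item 19630, OPEN) through twist stability of class
X9 and the modular parametrisation carried by `PublishedInputsX9`.

Honest status: this closes the SUPPORT item 26944 as typed (an implication); its antecedents `BRR2022_thm_1` (print,
cite-only; the route's item `BRR2022Thm1`) and `AnalyticMuZeroX9` (Greenberg LNM 1716 Conj. 1.11 on X9, item 19630, open)
remain binders of the route's `closes`;
no summit, leaf or crux is proved by this file; BSD is not proved.

References: [BeckwithRaumRichter2022] Thm. 1; [GreenbergLNM1716] Conj. 1.11; [BurungaleCastellaSkinner2025] §1.2,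
Lemma 5.2.3; [Cox2013] Thm. 7.24.
-/

set_option linter.dupNamespace false
set_option autoImplicit false

noncomputable section

namespace Summit.BirchSwinnertonDyer.BirchSwinnertonDyer.Theorems.SignedBalanceX9CoprimeFrame

/-- **Item `TwistedAnalyticMuZeroCoprimeX9OfPrint` (stmt-BirchSwinnertonDyer-26944) of route `SignedBalanceX9`, by name**:
`Literature.NumberTheory.QuadraticFields.BRR2022_thm_1 → AnalyticMuZeroX9 → PublishedInputsX9 → TwistedAnalyticMuZeroCoprimeX9`
is, once the definition is unfolded, the landed `twistedAnalyticMuZeroCoprimeX9_of_publishedInputs` (p607311).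
CONDITIONAL CONTENT made explicit by the statement itself (one print fact + Greenberg's analytic `μ = 0` on X9,
item 19630, OPEN); no crux is proved; BSD is not proved.
[cite: BeckwithRaumRichter2022, Theorem 1] [cite: GreenbergLNM1716, §1 Conj. 1.11]
[cite: BurungaleCastellaSkinner2025, Lemma 5.2.3] -/
theorem twistedAnalyticMuZeroCoprimeX9OfPrint_proof :
    Summit.BirchSwinnertonDyer.BirchSwinnertonDyer.Theses.SignedBalanceX9.TwistedAnalyticMuZeroCoprimeX9OfPrint := by
  unfold Summit.BirchSwinnertonDyer.BirchSwinnertonDyer.Theses.SignedBalanceX9.TwistedAnalyticMuZeroCoprimeX9OfPrint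
  exact twistedAnalyticMuZeroCoprimeX9_of_publishedInputs

end Summit.BirchSwinnertonDyer.BirchSwinnertonDyer.Theorems.SignedBalanceX9CoprimeFrame

end
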